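/-
Copyright: public-audit package `pub-balaban` (b2b-balaban), seats pv28-g5 / pv28-g6. Released under Apache 2.0 like Mathlib.
-/
import Literature.MathematicalPhysics.QuantumFieldTheory.Balaban1983to89.T4CoReadMoment

/-!
# T4 / O3b–H2: OFF A FLAT EXTERIOR THE PAIR MEAN IS AXIAL — the structural half of obligation O-G7, typed and
kernel-checked (pub-balaban, rows T4-O3.E-iii-b-AX* (v1) / -AX2* (v1.1) / -AX3* (v1.2), seats pv28-g5 / pv28-g6)

Companion of `T4CoReadMoment` §1 (K9).  There, under the hypothesis shape (k3) `FlatExteriorConjInvariant μ T` — the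
conditional law at a FLAT exterior is invariant under simultaneous conjugation by EVERY `h ∈ SU(2)` — the mean of any
conjugation-equivariant traceless insert, in particular of the commutator `[B_b, B_b′]` of two equivariant inserts,
vanishes (`integral_mcomm_eq_zero`, `pairMeanField_eq_zero`).  The record `t4/T4-EST-O3Eiiib.md` v2.1 §5 located the
caveat O-G7 (GAPS G-pv28g5-1): off a flat exterior the conditional law is AT BEST invariant under the STABILISER of the
exterior direction `Θ̂₀`, under which the pair mean `m₂(u)(b,b′) = E_u[B_b, B_b′]` may keep a `Θ̂₀`-component — exactly
the component the co-read coefficient contracts against.  This file TYPES that caveat and proves its structure.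

## What is proved (all [folklore]: 2 × 2 matrix algebra, invariance of the Bochner integral (T4AdInvariant (k2)),
one Dirac-mass computation)

* (A1) `AxisConjInvariant μ T` — the HYPOTHESIS SHAPE: the law is invariant under `T h` for the DIAGONAL `h ∈ SU(2)`
  only (`IsAxis h`: the U(1) stabiliser `{diag(w, w̄)}` of the axis `σ₃` under `Ad` — the residual symmetry of a
  uni-directional exterior along that axis).  `axisConjInvariant_of_flat`: implied by (k3).
* (A2) `apply_offDiag_eq_zero_of_phaseU_invariant`: a matrix (in the function type `Fin 2 → Fin 2 → ℂ`) fixed by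
  conjugation with `diag(i, −i) = T4AdInvariant.phaseU` (the π-rotation about the axis) has ZERO OFF-DIAGONAL entries;
  with zero trace it is `axial a = diag(a, −a)` for ONE complex scalar `a` (`eq_axial`).
* (A3) `integral_offDiag_eq_zero` / `integral_eq_axial`: under (A1) and `ConjEquivariant T f`, the mean of `f` has
  zero off-diagonal entries (no integrability, no tracelessness needed), and for pointwise traceless `f`,
  `∫ f ∂μ = axial ((∫ f ∂μ) 0 0)`.  TRICHOTOMY for the record: flat exterior (full SU(2)) ⇒ mean 0 (K9); uni-directional
  exterior (U(1)) ⇒ mean AXIAL, one scalar; generic exterior ⇒ stabiliser `{±1}` acting trivially, no constraint.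
* (A4) contractions: for every continuous ℝ-linear `ℓ` VANISHING ON AXIAL MATRICES (a "transverse" contraction),
  `∫ ℓ ∘ f ∂μ = 0` (integrable `f`; `integral_clm_eq_zero_of_transverse`); in general `∫ ℓ ∘ f = ℓ (axial a)` — the
  felt quantity is `ℓ` of ONE scalar (`integral_clm_eq_axial`).  Pair versions: `integral_mcomm_eq_axial`,
  `pairMeanField_eq_axial`, `pairMeanField_offDiag_eq_zero`, `integral_clm_mcomm_eq_zero_of_transverse` — O-G7's
  «may keep a Θ̂₀-component» made precise: the TRANSVERSE components of the pair mean are STILL killed by the residual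
  symmetry; the AXIAL scalar is the whole obstruction, and it is exactly what a contraction against the axis feels.
* (A5) SHARPNESS TOY (`Toy`): configuration space = the matrix space itself with the adjoint action, law = the Dirac
  mass at `diag(i, −i)`, insert = the identity: (A1) HOLDS (`toy_axisConjInvariant`), the insert is equivariant, its
  mean is `diag(i, −i) ≠ 0` (`toy_integral`, axial and non-zero), and the toy law is NOT (k3)-invariant
  (`toy_not_flat`, by (k2) at the rotation `swapU`).  So (A1) genuinely does not force a zero mean: the axial scalar
  can survive.  (The toy is a single insert; for COMMUTATOR means v1 proved the axial reduction (A4), not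
  survival — O-G7 says «may»; v1.1's (A5′) below settles survival for commutator means too.)
* (A1′) [v1.1, `Phase`, `PairMeanFieldPhase`; cross-read advisory A1 of v1, GAPS C-pv18g6-2] `PhaseConjInvariant μ T`:
  invariance under the SINGLE configuration map `T diag(i, −i)` (the π-rotation about the axis, generating a ℤ₄ inside
  the stabiliser) is ALL that (A2)–(A4) use — every structural statement is re-derived under it (`…_of_phase`);
  (k3) ⇒ (A1) ⇒ (A1′) (`AxisConjInvariant.phase`, `phaseConjInvariant_of_flat`).
* (A5′) [v1.1, `PairToy`] SHARPNESS FOR THE COMMUTATOR CHANNEL: on PAIRS of matrices with the simultaneous adjoint action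
  (`adAction₂`; the coordinate inserts are equivariant, `fst_/snd_conjEquivariant₂`), the fair two-point law
  `toyPairLaw = ½(δ_(E,F) + δ_(−E,−F))`, `E = [[0,1],[−1,0]]`, `F = [[0,i],[i,0]] ∈ 𝔰𝔲(2)`, is a probability measure with
  the symmetry (A1′) (`toyPair_phaseConjInvariant`: the π-rotation swaps the two atoms), its mean COMMUTATOR is
  `[E, F] = diag(2i, −2i)` (`toyPair_integral_pairComm`: axial, as (A4) predicts, and NON-ZERO), and it is not
  (k3)-invariant (`toyPair_not_flat`, by K9).  So the residual symmetry that the structural lemmas consume does NOT kill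
  the co-read commutator channel: O-G7's «may» is sharp at the level of symmetry, and the channel has to be priced by the
  moment seam (`T4CoReadMoment` K10/K11) with a genuinely non-zero first-order scalar per pair.
* (A5″) [v1.1] ORBIT LEMMA `pairComm_adAction₂_of_isAxis`: for `h` on the axis and a pair whose commutator is axial,
  `[h p.1 h⋆, h p.2 h⋆] = h [p.1, p.2] h⋆ = [p.1, p.2]` — the commutator insert is CONSTANT along the whole U(1) axis orbit;
  hence (`integral_pairComm_eq_of_orbit`) ANY probability law carried by the axis orbit of `(E, F)` — in particular the
  orbit measure, the natural fully (A1)-invariant instance (NOT constructed in v1.1; v1.2 constructs it, (A5‴) below) —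
  has mean commutator `diag(2i, −2i)`: averaging over the full residual U(1) cannot kill the channel either.
* (A3″) [v1.2, `Transverse`] `integral_eq_zero_of_ae_transverse(_of_phase)`: under (A1′) (hence (A1), (k3)) an
  equivariant insert with a.e. ZERO DIAGONAL (a transverse insert) has mean ZERO — off-diagonal entries by (A3), diagonal
  entries as means of a.e.-null scalars (`entryOp`, `integral_apply_eq`); no integrability needed.
* (A5‴) [v1.2, `OrbitMeasure`] THE ORBIT MEASURE, CONSTRUCTED: `orbitLaw` = image of the Haar probability measure of
  `ℝ/ℤ` (`AddCircle.haarAddCircle`) under `θ ↦ orbitPt (e^{2πiθ})`, `orbitPt u = (offDiag u (−ū), offDiag (iu) (iū))` the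
  U(1) axis orbit of `(E, F)` (`orbitPt 1 = (E, F)`; `Ad(diag(w, w̄))` acts by `u ↦ w²u`, `adAction₂_axisU_orbitPt`; every
  axis element is `diag(w, w̄)`, `IsAxis.exists_eq_axisU`).  KERNEL FACTS: `orbitLaw` is a probability measure; it HAS THE
  FULL residual symmetry (A1) (`orbitLaw_axisConjInvariant`, by translation invariance of Haar measure — not merely (A1′));
  it is carried by the axis orbit (`orbitLaw_ae_mem_orbit`), so by (A5″) its mean commutator is `[E, F] = diag(2i, −2i) ≠ 0`
  (`orbitLaw_integral_pairComm(_ne_zero)`) and it is NOT (k3)-invariant (`orbitLaw_not_flat`); each SINGLE coordinate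
  insert has mean `0` under it (`orbitLaw_integral_fst/_snd`, by (A3″)) — first order averages out over the residual U(1),
  the commutator does not.  Contrast, cross-read advisory A2 of v1.1 (C-pv04g8-3) made a kernel fact: the pair toy law of
  (A5′) is (A1′)- but NOT (A1)-invariant (`toyPair_not_axisConjInvariant`: `Ad(diag(w, w̄))` with `w² = i` moves both
  atoms); the orbit measure is the (A1)-invariant law on the same orbit.  So (A5″)'s conclusion is now UNCONDITIONAL: an
  (A1)-invariant probability law with non-zero (axial) mean commutator EXISTS.

## HONEST SCOPE

Nothing printed is asserted or used; no decl carries a `[cite:]` tag; B12/B13 are not even locations here — the file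
is about the cell's own hypothesis shapes (k3)/(A1).  Whether Bałaban's conditional law at a curved exterior has the
residual invariance (A1) is the same un-printed species as (k3) itself (row T4-O3.E-i′ (α)); the QUANTITATIVE half of
O-G7 — a Lipschitz modulus `|a(u)(b,b′)| ≤ lip₂·dev u` for the surviving axial scalar (the pair twin of the single-insert
shape `T4AxialChain.meanLipschitz_of_segment` / hypothesis `hL` of `T4CoReadMoment.pairMean_norm_le_of_lipschitz`) —
stays OPEN and un-printed; this file only shows that it is needed for ONE real-analytic scalar per pair, not for a
matrix, and (v1.1, (A5′)/(A5″)) that NO symmetry consideration can replace it — (v1.2, (A5‴)) not even averaging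
over the FULL residual U(1): the orbit measure is an (A1)-invariant probability law, strictly outside (k3), whose single
inserts have mean `0` and whose mean commutator is `diag(2i, −2i)`.  The objects `E`, `F`, `orbitPt`, `orbitLaw` are TOYS
on the matrix space, labelled so; nothing is claimed about Bałaban's conditional law.  Value: typed hypothesis + kernel
structure lemma + sharpness toys, NOT summit progress.

v1.1 (same seat, 2026-08-19): APPEND-ONLY w.r.t. v1 (p181699, commit cad6a9ccaf02): v1's 28 declarations keep their
names, statements and proofs; added §2bis (A1′) and §3bis (A5′)/(A5″); the `open … T4CoReadMoment (…)` list gains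
`mprod`, `integral_mcomm_eq_zero`.

v1.2 (seat pv28-g6, 2026-08-19, row T4-O3.E-iii-b-AX3*): APPEND-ONLY w.r.t. v1.1 (p181837, commit 25af66272e22): the
declaration region of v1.1 (from `noncomputable section` to `end PairToy`, 63 declarations) is BYTE-IDENTICAL; only this
module docstring is amended; added §2ter (A3″) (`Transverse`: `entryOp`, `entryOp_apply`, `integral_apply_eq`,
`integral_eq_zero_of_ae_transverse_of_phase`, `integral_eq_zero_of_ae_transverse`; 5 declarations) and §3ter (A5‴)
(`OrbitMeasure`, 43 declarations): 48 new, 111 source declarations in all.  The docstring of v1.1's `integral_pairComm_eq_of_orbit` still reads «not constructed here» — superseded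
by §3ter, left untouched to keep the v1.1 region byte-identical.  Imports unchanged (`AddCircle.haarAddCircle`,
`AddCircle.toCircle`, `Circle` come with Mathlib through `T4AdInvariant`).  All new declarations [folklore]; no `[cite:]`.
-/

noncomputable section

open MeasureTheory Complex

namespace Literature.MathematicalPhysics.QuantumFieldTheory.Balaban1983to89.T4CoReadAxial

open Literature.MathematicalPhysics.QuantumFieldTheory.Balaban1983to89.T4AdInvariant
open Literature.MathematicalPhysics.QuantumFieldTheory.Balaban1983to89.T4CoReadMoment
  (mprod mcomm trace_mcomm conjEquivariant_mcomm integral_mcomm_eq_zero pairMeanField)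

/-! ## §1 (A2)  Algebra: axial matrices; the π-rotation about the axis kills the off-diagonal entries -/

section Algebra

/-- The AXIAL matrix `diag(a, −a)` (a multiple of `σ₃`; for `a ∈ iℝ` an element of 𝔰𝔲(2) along the axis), in the
function type `Fin 2 → Fin 2 → ℂ`. [folklore] -/
def axial (a : ℂ) : Fin 2 → Fin 2 → ℂ := ![![a, 0], ![0, -a]]

/-- entry (0,0) of `axial a` is `a`. [folklore] -/
@[simp] theorem axial_apply_00 (a : ℂ) : axial a 0 0 = a := rfl

/-- entry (0,1) of `axial a` is `0`. [folklore] -/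
@[simp] theorem axial_apply_01 (a : ℂ) : axial a 0 1 = 0 := rfl

/-- entry (1,0) of `axial a` is `0`. [folklore] -/
@[simp] theorem axial_apply_10 (a : ℂ) : axial a 1 0 = 0 := rfl

/-- entry (1,1) of `axial a` is `−a`. [folklore] -/
@[simp] theorem axial_apply_11 (a : ℂ) : axial a 1 1 = -a := rfl

/-- `axial a = 0 ↔ a = 0`. [folklore] -/
theorem axial_eq_zero_iff (a : ℂ) : axial a = 0 ↔ a = 0 := by
  constructor
  · intro h
    have := congrFun (congrFun h 0) 0
    simpa using this
  · rintro rfl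
    funext i j
    fin_cases i <;> fin_cases j <;> simp

/-- A matrix with zero off-diagonal entries and zero trace IS `axial (its (0,0) entry)`. [folklore] -/
theorem eq_axial (v : Fin 2 → Fin 2 → ℂ) (h01 : v 0 1 = 0) (h10 : v 1 0 = 0) (htr : v 0 0 + v 1 1 = 0) :
    v = axial (v 0 0) := by
  funext i j
  fin_cases i <;> fin_cases j
  · rfl
  · exact h01
  · exact h10
  · show v 1 1 = -v 0 0
    linear_combination htr

/-- An element of SU(2) is ON THE AXIS (diagonal, `diag(w, w̄)` with `|w| = 1`): the U(1) stabiliser of `σ₃` under the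
adjoint action. [folklore] -/
def IsAxis (h : Matrix.specialUnitaryGroup (Fin 2) ℂ) : Prop :=
  (h : Matrix (Fin 2) (Fin 2) ℂ) 0 1 = 0 ∧ (h : Matrix (Fin 2) (Fin 2) ℂ) 1 0 = 0

/-- `diag(i, −i)` is on the axis. [folklore] -/
theorem phaseU_isAxis : IsAxis ⟨phaseU, phaseU_mem⟩ := by
  constructor <;> simp [phaseU]

/-- **(A2)** a matrix fixed by conjugation with `diag(i, −i)` (the rotation by π about the axis, which NEGATES the
off-diagonal entries: `T4AdInvariant.phaseU_conj_apply_01/_10`) has zero off-diagonal entries. [folklore] -/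
theorem apply_offDiag_eq_zero_of_phaseU_invariant (v : Fin 2 → Fin 2 → ℂ) (h : conjOp phaseU v = v) :
    v 0 1 = 0 ∧ v 1 0 = 0 := by
  have h01 := congrFun (congrFun h 0) 1
  have h10 := congrFun (congrFun h 1) 0
  rw [conjOp_apply, phaseU_conj_apply_01, Matrix.of_apply] at h01
  rw [conjOp_apply, phaseU_conj_apply_10, Matrix.of_apply] at h10
  constructor
  · have h2 : (2 : ℂ) * v 0 1 = 0 := by linear_combination (-1 : ℂ) * h01
    exact (mul_eq_zero.mp h2).resolve_left two_ne_zero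
  · have h2 : (2 : ℂ) * v 1 0 = 0 := by linear_combination (-1 : ℂ) * h10
    exact (mul_eq_zero.mp h2).resolve_left two_ne_zero

/-- Diagonal unitaries FIX axial matrices: `h · diag(a, −a) · h⋆ = diag(a, −a)` for `h` on the axis (diagonal
matrices commute; `h h⋆ = 1`). [folklore] -/
theorem conjOp_axial_of_isAxis (h : Matrix.specialUnitaryGroup (Fin 2) ℂ) (hh : IsAxis h) (a : ℂ) :
    conjOp (h : Matrix (Fin 2) (Fin 2) ℂ) (axial a) = axial a := by
  obtain ⟨h01, h10⟩ := hh
  have hUU : (h : Matrix (Fin 2) (Fin 2) ℂ) * star (h : Matrix (Fin 2) (Fin 2) ℂ) = 1 := h.prop.1.2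
  have hcomm : (h : Matrix (Fin 2) (Fin 2) ℂ) * Matrix.of (axial a) = Matrix.of (axial a) * (h : Matrix _ _ ℂ) := by
    ext i j
    fin_cases i <;> fin_cases j <;>
      simp [Matrix.mul_apply, Fin.sum_univ_two, Matrix.of_apply, h01, h10, mul_comm]
  funext i j
  rw [conjOp_apply, hcomm, Matrix.mul_assoc, hUU, Matrix.mul_one, Matrix.of_apply]

end Algebra

/-! ## §2 (A1)/(A3)  The residual-symmetry hypothesis and the axial mean -/

section Mean

variable {X : Type*} [MeasurableSpace X] {μ : Measure X} {T : Matrix.specialUnitaryGroup (Fin 2) ℂ → X → X}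

/-- **(A1) HYPOTHESIS SHAPE** (not a fact): the law `μ` is invariant under the configuration maps `T h` for the
DIAGONAL `h ∈ SU(2)` — the U(1) stabiliser of the axis; the residual symmetry of a conditional law at a uni-directional
(non-flat) exterior along that axis.  Weaker than (k3) `FlatExteriorConjInvariant μ T`. [folklore] -/
def AxisConjInvariant (μ : Measure X) (T : Matrix.specialUnitaryGroup (Fin 2) ℂ → X → X) : Prop :=
  ∀ h, IsAxis h → AEMeasurable (T h) μ ∧ Measure.map (T h) μ = μ

/-- (k3) implies (A1). [folklore] -/
theorem axisConjInvariant_of_flat (hμ : FlatExteriorConjInvariant μ T) : AxisConjInvariant μ T :=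
  fun h _ => hμ h

/-- **(A3) OFF-DIAGONAL ENTRIES OF THE MEAN VANISH** under (A1) and equivariance — no integrability and no tracelessness
needed (non-integrable ⇒ the mean is the junk value 0). [folklore] -/
theorem integral_offDiag_eq_zero (hμ : AxisConjInvariant μ T) {f : X → Fin 2 → Fin 2 → ℂ}
    (hf : ConjEquivariant T f) : (∫ x, f x ∂μ) 0 1 = 0 ∧ (∫ x, f x ∂μ) 1 0 = 0 := by
  have hP := hμ ⟨phaseU, phaseU_mem⟩ phaseU_isAxis
  exact apply_offDiag_eq_zero_of_phaseU_invariant _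
    (integral_fixed_of_invariant hP.1 hP.2 (conjOp phaseU) (hf ⟨phaseU, phaseU_mem⟩))

/-- **(A3) THE MEAN IS AXIAL**: under (A1), equivariance and pointwise tracelessness, `∫ f ∂μ = diag(a, −a)` with
`a = (∫ f ∂μ) 0 0` — ONE complex scalar survives (K9′; at a flat exterior K9 gives `a = 0`). [folklore] -/
theorem integral_eq_axial (hμ : AxisConjInvariant μ T) {f : X → Fin 2 → Fin 2 → ℂ} (hf : ConjEquivariant T f)
    (htr : ∀ x, f x 0 0 + f x 1 1 = 0) : ∫ x, f x ∂μ = axial ((∫ x, f x ∂μ) 0 0) :=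
  have h := integral_offDiag_eq_zero hμ hf
  eq_axial _ h.1 h.2 (trace_integral_eq_zero htr)

variable {F : Type*} [NormedAddCommGroup F] [NormedSpace ℝ F] [CompleteSpace F]

/-- **(A4) TRANSVERSE CONTRACTIONS STILL VANISH**: for a continuous ℝ-linear `ℓ` that vanishes on axial matrices,
`∫ ℓ (f x) ∂μ = 0` (integrable `f`). [folklore] -/
theorem integral_clm_eq_zero_of_transverse (hμ : AxisConjInvariant μ T) {f : X → Fin 2 → Fin 2 → ℂ}
    (hf : ConjEquivariant T f) (htr : ∀ x, f x 0 0 + f x 1 1 = 0) (ℓ : (Fin 2 → Fin 2 → ℂ) →L[ℝ] F)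
    (hℓ : ∀ a, ℓ (axial a) = 0) (hint : Integrable f μ) : ∫ x, ℓ (f x) ∂μ = 0 := by
  rw [ContinuousLinearMap.integral_comp_comm ℓ hint, integral_eq_axial hμ hf htr, hℓ]

/-- **(A4) WHAT IS FELT IS ONE SCALAR**: for any continuous ℝ-linear `ℓ` (e.g. the real contraction against the axis
direction `Θ̂₀` itself), `∫ ℓ (f x) ∂μ = ℓ (diag(a, −a))`, `a = (∫ f) 0 0` (integrable `f`). [folklore] -/
theorem integral_clm_eq_axial (hμ : AxisConjInvariant μ T) {f : X → Fin 2 → Fin 2 → ℂ}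
    (hf : ConjEquivariant T f) (htr : ∀ x, f x 0 0 + f x 1 1 = 0) (ℓ : (Fin 2 → Fin 2 → ℂ) →L[ℝ] F)
    (hint : Integrable f μ) : ∫ x, ℓ (f x) ∂μ = ℓ (axial ((∫ x, f x ∂μ) 0 0)) := by
  rw [ContinuousLinearMap.integral_comp_comm ℓ hint]
  exact congrArg ℓ (integral_eq_axial hμ hf htr)

/-! ### Commutator inserts and the pair mean field (O-G7) -/

/-- **(A4, pairs)** under (A1) the mean of the commutator of two equivariant inserts is AXIAL (the commutator is
equivariant and traceless by itself, `T4CoReadMoment.conjEquivariant_mcomm` / `trace_mcomm`). [folklore] -/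
theorem integral_mcomm_eq_axial (hμ : AxisConjInvariant μ T) {f g : X → Fin 2 → Fin 2 → ℂ}
    (hf : ConjEquivariant T f) (hg : ConjEquivariant T g) :
    ∫ x, mcomm f g x ∂μ = axial ((∫ x, mcomm f g x ∂μ) 0 0) :=
  integral_eq_axial hμ (conjEquivariant_mcomm hf hg) (trace_mcomm f g)

/-- (A4, pairs) transverse contractions of the commutator mean vanish (integrable commutator). [folklore] -/
theorem integral_clm_mcomm_eq_zero_of_transverse (hμ : AxisConjInvariant μ T) {f g : X → Fin 2 → Fin 2 → ℂ}
    (hf : ConjEquivariant T f) (hg : ConjEquivariant T g) (ℓ : (Fin 2 → Fin 2 → ℂ) →L[ℝ] F)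
    (hℓ : ∀ a, ℓ (axial a) = 0) (hint : Integrable (mcomm f g) μ) : ∫ x, ℓ (mcomm f g x) ∂μ = 0 :=
  integral_clm_eq_zero_of_transverse hμ (conjEquivariant_mcomm hf hg) (trace_mcomm f g) ℓ hℓ hint

end Mean

section PairMeanField

variable {Ω : Type*} [MeasurableSpace Ω] {β : Type*} {P : Measure Ω}
  {T : Matrix.specialUnitaryGroup (Fin 2) ℂ → Ω → Ω}

/-- **O-G7, STRUCTURAL HALF**: at a law with the residual axis symmetry (A1), the pair mean field
`m₂ (b, b′) = ∫ [B ω b, B ω b′] dP(ω)` of `T4CoReadMoment` is AXIAL at every pair — `m₂ p = diag(a_p, −a_p)`; compare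
`pairMeanField_eq_zero` (flat: `m₂ = 0`). [folklore] -/
theorem pairMeanField_eq_axial (hP : AxisConjInvariant P T) {B : Ω → β → Fin 2 → Fin 2 → ℂ}
    (hB : ∀ b, ConjEquivariant T (fun ω => B ω b)) (p : β × β) :
    pairMeanField P B p = axial (pairMeanField P B p 0 0) :=
  integral_mcomm_eq_axial hP (hB p.1) (hB p.2)

/-- … in particular its TRANSVERSE (off-diagonal) components vanish at every pair. [folklore] -/
theorem pairMeanField_offDiag_eq_zero (hP : AxisConjInvariant P T) {B : Ω → β → Fin 2 → Fin 2 → ℂ}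
    (hB : ∀ b, ConjEquivariant T (fun ω => B ω b)) (p : β × β) :
    pairMeanField P B p 0 1 = 0 ∧ pairMeanField P B p 1 0 = 0 :=
  integral_offDiag_eq_zero hP (conjEquivariant_mcomm (hB p.1) (hB p.2))

end PairMeanField

/-! ## §3 (A5)  Sharpness toy: the axial scalar can survive under (A1) -/

section Toy

/-- The toy configuration space is the matrix space itself, acted on by conjugation. [folklore] -/
def adAction (h : Matrix.specialUnitaryGroup (Fin 2) ℂ) (x : Fin 2 → Fin 2 → ℂ) : Fin 2 → Fin 2 → ℂ :=
  conjOp (h : Matrix (Fin 2) (Fin 2) ℂ) x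

/-- The toy law: the Dirac mass at the axial configuration `diag(i, −i)`. [folklore] -/
def toyLaw : Measure (Fin 2 → Fin 2 → ℂ) := Measure.dirac (axial I)

/-- The identity insert is conjugation-equivariant for the adjoint action (by definition). [folklore] -/
theorem toy_conjEquivariant : ConjEquivariant adAction (fun x : Fin 2 → Fin 2 → ℂ => x) := fun _ _ => rfl

/-- **(A5)** the toy law HAS the residual axis symmetry (A1): diagonal unitaries fix `diag(i, −i)`. [folklore] -/
theorem toy_axisConjInvariant : AxisConjInvariant toyLaw adAction := by
  intro h hh
  have hmeas : Measurable (adAction h) := (conjOp (h : Matrix (Fin 2) (Fin 2) ℂ)).continuous.measurable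
  refine ⟨hmeas.aemeasurable, ?_⟩
  rw [toyLaw, Measure.map_dirac' hmeas]
  show Measure.dirac (conjOp (h : Matrix (Fin 2) (Fin 2) ℂ) (axial I)) = _
  rw [conjOp_axial_of_isAxis h hh]

/-- The toy mean IS the axial configuration: `∫ x dδ_{diag(i,−i)}(x) = diag(i, −i)`. [folklore] -/
theorem toy_integral : ∫ x, x ∂toyLaw = axial I := by
  rw [toyLaw, integral_dirac]

/-- … which is non-zero: under (A1) the mean of an equivariant traceless insert NEED NOT vanish. [folklore] -/
theorem toy_integral_ne_zero : ∫ x, x ∂toyLaw ≠ 0 := by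
  rw [toy_integral, Ne, axial_eq_zero_iff]
  exact I_ne_zero

/-- **(A5)** and the toy law is NOT (k3)-invariant: by (k2) at the rotation `swapU` a (k3)-invariant law would give a
`swapU`-fixed mean, but `swapU · diag(i,−i) · swapU⋆` has (0,0) entry `−i ≠ i` (`swapU_conj_apply_00`).  So (A1) is
STRICTLY weaker than (k3) and K9's conclusion genuinely fails under (A1) alone. [folklore] -/
theorem toy_not_flat : ¬ FlatExteriorConjInvariant toyLaw adAction := by
  intro hflat
  have h := integral_fixed_of_invariant (hflat ⟨swapU, swapU_mem⟩).1 (hflat ⟨swapU, swapU_mem⟩).2 (conjOp swapU)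
    (f := fun x : Fin 2 → Fin 2 → ℂ => x) (fun _ => rfl)
  rw [toy_integral] at h
  have h00 := congrFun (congrFun h 0) 0
  rw [conjOp_apply, swapU_conj_apply_00, Matrix.of_apply, axial_apply_11, axial_apply_00] at h00
  have h2 : (2 : ℂ) * I = 0 := by linear_combination (-1 : ℂ) * h00
  exact I_ne_zero ((mul_eq_zero.mp h2).resolve_left two_ne_zero)

end Toy

/-! ## §2bis (A1′)  The single-element hypothesis: invariance under the π-rotation `diag(i, −i)` is all that is used
(v1.1; cross-read advisory A1 of v1, C-pv18g6-2) -/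

section Phase

variable {X : Type*} [MeasurableSpace X] {μ : Measure X} {T : Matrix.specialUnitaryGroup (Fin 2) ℂ → X → X}

/-- **(A1′) HYPOTHESIS SHAPE** (not a fact): the law `μ` is invariant under the ONE configuration map `T diag(i, −i)` —
the rotation by π about the axis (it generates a ℤ₄ inside the axis stabiliser).  This is all that (A2)–(A4) consume;
(k3) ⇒ (A1) ⇒ (A1′). [folklore] -/
def PhaseConjInvariant (μ : Measure X) (T : Matrix.specialUnitaryGroup (Fin 2) ℂ → X → X) : Prop :=
  AEMeasurable (T ⟨phaseU, phaseU_mem⟩) μ ∧ Measure.map (T ⟨phaseU, phaseU_mem⟩) μ = μ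

/-- (A1) ⇒ (A1′). [folklore] -/
theorem AxisConjInvariant.phase (hμ : AxisConjInvariant μ T) : PhaseConjInvariant μ T :=
  hμ ⟨phaseU, phaseU_mem⟩ phaseU_isAxis

/-- (k3) ⇒ (A1′). [folklore] -/
theorem phaseConjInvariant_of_flat (hμ : FlatExteriorConjInvariant μ T) : PhaseConjInvariant μ T :=
  hμ ⟨phaseU, phaseU_mem⟩

/-- (A3) under (A1′): the mean of an equivariant insert has zero off-diagonal entries (no integrability, no
tracelessness). [folklore] -/
theorem integral_offDiag_eq_zero_of_phase (hμ : PhaseConjInvariant μ T) {f : X → Fin 2 → Fin 2 → ℂ}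
    (hf : ConjEquivariant T f) : (∫ x, f x ∂μ) 0 1 = 0 ∧ (∫ x, f x ∂μ) 1 0 = 0 :=
  apply_offDiag_eq_zero_of_phaseU_invariant _
    (integral_fixed_of_invariant hμ.1 hμ.2 (conjOp phaseU) (hf ⟨phaseU, phaseU_mem⟩))

/-- (A3) under (A1′): for pointwise traceless equivariant `f`, `∫ f ∂μ = diag(a, −a)`, `a = (∫ f ∂μ) 0 0`. [folklore] -/
theorem integral_eq_axial_of_phase (hμ : PhaseConjInvariant μ T) {f : X → Fin 2 → Fin 2 → ℂ}
    (hf : ConjEquivariant T f) (htr : ∀ x, f x 0 0 + f x 1 1 = 0) :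
    ∫ x, f x ∂μ = axial ((∫ x, f x ∂μ) 0 0) :=
  have h := integral_offDiag_eq_zero_of_phase hμ hf
  eq_axial _ h.1 h.2 (trace_integral_eq_zero htr)

variable {F : Type*} [NormedAddCommGroup F] [NormedSpace ℝ F] [CompleteSpace F]

/-- (A4) under (A1′): transverse contractions of the mean vanish (integrable `f`). [folklore] -/
theorem integral_clm_eq_zero_of_transverse_of_phase (hμ : PhaseConjInvariant μ T) {f : X → Fin 2 → Fin 2 → ℂ}
    (hf : ConjEquivariant T f) (htr : ∀ x, f x 0 0 + f x 1 1 = 0) (ℓ : (Fin 2 → Fin 2 → ℂ) →L[ℝ] F)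
    (hℓ : ∀ a, ℓ (axial a) = 0) (hint : Integrable f μ) : ∫ x, ℓ (f x) ∂μ = 0 := by
  rw [ContinuousLinearMap.integral_comp_comm ℓ hint, integral_eq_axial_of_phase hμ hf htr, hℓ]

/-- (A4) under (A1′): what is felt is `ℓ` of ONE scalar (integrable `f`). [folklore] -/
theorem integral_clm_eq_axial_of_phase (hμ : PhaseConjInvariant μ T) {f : X → Fin 2 → Fin 2 → ℂ}
    (hf : ConjEquivariant T f) (htr : ∀ x, f x 0 0 + f x 1 1 = 0) (ℓ : (Fin 2 → Fin 2 → ℂ) →L[ℝ] F)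
    (hint : Integrable f μ) : ∫ x, ℓ (f x) ∂μ = ℓ (axial ((∫ x, f x ∂μ) 0 0)) := by
  rw [ContinuousLinearMap.integral_comp_comm ℓ hint]
  exact congrArg ℓ (integral_eq_axial_of_phase hμ hf htr)

/-- (A4, pairs) under (A1′): the mean of the commutator of two equivariant inserts is axial. [folklore] -/
theorem integral_mcomm_eq_axial_of_phase (hμ : PhaseConjInvariant μ T) {f g : X → Fin 2 → Fin 2 → ℂ}
    (hf : ConjEquivariant T f) (hg : ConjEquivariant T g) :
    ∫ x, mcomm f g x ∂μ = axial ((∫ x, mcomm f g x ∂μ) 0 0) :=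
  integral_eq_axial_of_phase hμ (conjEquivariant_mcomm hf hg) (trace_mcomm f g)

/-- (A4, pairs) under (A1′): transverse contractions of the commutator mean vanish (integrable commutator).
[folklore] -/
theorem integral_clm_mcomm_eq_zero_of_transverse_of_phase (hμ : PhaseConjInvariant μ T)
    {f g : X → Fin 2 → Fin 2 → ℂ} (hf : ConjEquivariant T f) (hg : ConjEquivariant T g)
    (ℓ : (Fin 2 → Fin 2 → ℂ) →L[ℝ] F) (hℓ : ∀ a, ℓ (axial a) = 0) (hint : Integrable (mcomm f g) μ) :
    ∫ x, ℓ (mcomm f g x) ∂μ = 0 :=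
  integral_clm_eq_zero_of_transverse_of_phase hμ (conjEquivariant_mcomm hf hg) (trace_mcomm f g) ℓ hℓ hint

end Phase

section PairMeanFieldPhase

variable {Ω : Type*} [MeasurableSpace Ω] {β : Type*} {P : Measure Ω}
  {T : Matrix.specialUnitaryGroup (Fin 2) ℂ → Ω → Ω}

/-- O-G7 structural half under (A1′): the pair mean field is axial at every pair. [folklore] -/
theorem pairMeanField_eq_axial_of_phase (hP : PhaseConjInvariant P T) {B : Ω → β → Fin 2 → Fin 2 → ℂ}
    (hB : ∀ b, ConjEquivariant T (fun ω => B ω b)) (p : β × β) :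
    pairMeanField P B p = axial (pairMeanField P B p 0 0) :=
  integral_mcomm_eq_axial_of_phase hP (hB p.1) (hB p.2)

/-- … and its off-diagonal components vanish at every pair. [folklore] -/
theorem pairMeanField_offDiag_eq_zero_of_phase (hP : PhaseConjInvariant P T) {B : Ω → β → Fin 2 → Fin 2 → ℂ}
    (hB : ∀ b, ConjEquivariant T (fun ω => B ω b)) (p : β × β) :
    pairMeanField P B p 0 1 = 0 ∧ pairMeanField P B p 1 0 = 0 :=
  integral_offDiag_eq_zero_of_phase hP (conjEquivariant_mcomm (hB p.1) (hB p.2))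

end PairMeanFieldPhase

/-! ## §3bis (A5′)/(A5″)  Sharpness for the COMMUTATOR channel (v1.1): the axial scalar of a pair mean can survive -/

section PairToy

/-- Pairs of matrices with the SIMULTANEOUS adjoint action. [folklore] -/
def adAction₂ (h : Matrix.specialUnitaryGroup (Fin 2) ℂ) :
    (Fin 2 → Fin 2 → ℂ) × (Fin 2 → Fin 2 → ℂ) → (Fin 2 → Fin 2 → ℂ) × (Fin 2 → Fin 2 → ℂ) :=
  Prod.map (adAction h) (adAction h)

/-- `adAction₂ h` is measurable (it is continuous). [folklore] -/
theorem measurable_adAction₂ (h : Matrix.specialUnitaryGroup (Fin 2) ℂ) : Measurable (adAction₂ h) :=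
  ((conjOp (h : Matrix (Fin 2) (Fin 2) ℂ)).continuous.prodMap
    (conjOp (h : Matrix (Fin 2) (Fin 2) ℂ)).continuous).measurable

/-- The first coordinate insert is equivariant for the simultaneous action (by definition). [folklore] -/
theorem fst_conjEquivariant₂ :
    ConjEquivariant adAction₂ (fun p : (Fin 2 → Fin 2 → ℂ) × (Fin 2 → Fin 2 → ℂ) => p.1) := fun _ _ => rfl

/-- The second coordinate insert is equivariant for the simultaneous action (by definition). [folklore] -/
theorem snd_conjEquivariant₂ :
    ConjEquivariant adAction₂ (fun p : (Fin 2 → Fin 2 → ℂ) × (Fin 2 → Fin 2 → ℂ) => p.2) := fun _ _ => rfl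

/-- The pointwise commutator insert of a pair, `p ↦ [p.1, p.2]`. [folklore] -/
def pairComm : (Fin 2 → Fin 2 → ℂ) × (Fin 2 → Fin 2 → ℂ) → Fin 2 → Fin 2 → ℂ :=
  mcomm (fun p => p.1) (fun p => p.2)

/-- `pairComm` is equivariant for the simultaneous action (`T4CoReadMoment.conjEquivariant_mcomm`). [folklore] -/
theorem pairComm_conjEquivariant : ConjEquivariant adAction₂ pairComm :=
  conjEquivariant_mcomm fst_conjEquivariant₂ snd_conjEquivariant₂

/-- The first test insert value `E = [[0, 1], [−1, 0]] ∈ 𝔰𝔲(2)`. [folklore] -/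
def toyE : Fin 2 → Fin 2 → ℂ := ![![0, 1], ![-1, 0]]

/-- The second test insert value `F = [[0, i], [i, 0]] ∈ 𝔰𝔲(2)`. [folklore] -/
def toyF : Fin 2 → Fin 2 → ℂ := ![![0, I], ![I, 0]]

/-- `[E, F] = diag(2i, −2i)` — AXIAL and non-zero. [folklore] -/
theorem pairComm_toy : pairComm (toyE, toyF) = axial (2 * I) := by
  funext i j
  fin_cases i <;> fin_cases j <;>
    simp [pairComm, mcomm, mprod, Matrix.mul_apply, Fin.sum_univ_two, Matrix.of_apply, toyE, toyF, axial] <;> ring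

/-- `[−E, −F] = [E, F]`. [folklore] -/
theorem pairComm_neg (p : (Fin 2 → Fin 2 → ℂ) × (Fin 2 → Fin 2 → ℂ)) : pairComm (-p.1, -p.2) = pairComm p := by
  funext i j
  simp only [pairComm, mcomm, mprod, Matrix.mul_apply, Fin.sum_univ_two, Matrix.of_apply, Pi.neg_apply,
    Pi.sub_apply]
  ring

/-- Conjugation by `diag(i, −i)` NEGATES a matrix with zero diagonal. [folklore] -/
theorem conjOp_phaseU_of_diag_eq_zero (v : Fin 2 → Fin 2 → ℂ) (h00 : v 0 0 = 0) (h11 : v 1 1 = 0) :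
    conjOp phaseU v = -v := by
  funext i j
  rw [conjOp_apply, Pi.neg_apply, Pi.neg_apply]
  fin_cases i <;> fin_cases j
  · show (phaseU * Matrix.of v * star phaseU) 0 0 = -v 0 0
    rw [h00, neg_zero]
    simp [Matrix.mul_apply, Fin.sum_univ_two, Matrix.star_apply, phaseU, Matrix.vecHead, Matrix.vecTail, h00]
  · exact phaseU_conj_apply_01 (Matrix.of v)
  · exact phaseU_conj_apply_10 (Matrix.of v)
  · show (phaseU * Matrix.of v * star phaseU) 1 1 = -v 1 1
    rw [h11, neg_zero]
    simp [Matrix.mul_apply, Fin.sum_univ_two, Matrix.star_apply, phaseU, Matrix.vecHead, Matrix.vecTail, h11]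

/-- `diag(i, −i) · E · diag(i, −i)⋆ = −E`. [folklore] -/
theorem adAction_phaseU_toyE : adAction ⟨phaseU, phaseU_mem⟩ toyE = -toyE :=
  conjOp_phaseU_of_diag_eq_zero toyE rfl rfl

/-- `diag(i, −i) · F · diag(i, −i)⋆ = −F`. [folklore] -/
theorem adAction_phaseU_toyF : adAction ⟨phaseU, phaseU_mem⟩ toyF = -toyF :=
  conjOp_phaseU_of_diag_eq_zero toyF rfl rfl

/-- The π-rotation SWAPS the two atoms `(E, F)` and `(−E, −F)`. [folklore] -/
theorem adAction₂_phaseU_toy : adAction₂ ⟨phaseU, phaseU_mem⟩ (toyE, toyF) = (-toyE, -toyF) := by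
  simp only [adAction₂, Prod.map_apply, adAction_phaseU_toyE, adAction_phaseU_toyF]

/-- … and back. [folklore] -/
theorem adAction₂_phaseU_toy_neg : adAction₂ ⟨phaseU, phaseU_mem⟩ (-toyE, -toyF) = (toyE, toyF) := by
  have h1 : adAction ⟨phaseU, phaseU_mem⟩ (-toyE) = toyE := by
    rw [show adAction ⟨phaseU, phaseU_mem⟩ (-toyE) = -adAction ⟨phaseU, phaseU_mem⟩ toyE from map_neg _ _,
      adAction_phaseU_toyE, neg_neg]
  have h2 : adAction ⟨phaseU, phaseU_mem⟩ (-toyF) = toyF := by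
    rw [show adAction ⟨phaseU, phaseU_mem⟩ (-toyF) = -adAction ⟨phaseU, phaseU_mem⟩ toyF from map_neg _ _,
      adAction_phaseU_toyF, neg_neg]
  simp only [adAction₂, Prod.map_apply, h1, h2]

/-- **THE PAIR TOY LAW**: the fair two-point law on the atoms `(E, F)` and `(−E, −F)` — a ℤ₂-orbit of the
π-rotation inside the U(1) axis orbit of the pair. [folklore] -/
def toyPairLaw : Measure ((Fin 2 → Fin 2 → ℂ) × (Fin 2 → Fin 2 → ℂ)) :=
  (2 : ENNReal)⁻¹ • (Measure.dirac (toyE, toyF) + Measure.dirac (-toyE, -toyF))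

/-- The pair toy law is a probability measure. [folklore] -/
instance toyPairLaw_isProbabilityMeasure : IsProbabilityMeasure toyPairLaw := by
  refine ⟨?_⟩
  rw [toyPairLaw, Measure.smul_apply, Measure.add_apply, measure_univ, measure_univ, smul_eq_mul]
  rw [show (1 : ENNReal) + 1 = 2 by norm_num]
  exact ENNReal.inv_mul_cancel two_ne_zero ENNReal.ofNat_ne_top

/-- **(A5′)** the pair toy law HAS the single-element symmetry (A1′). [folklore] -/
theorem toyPair_phaseConjInvariant : PhaseConjInvariant toyPairLaw adAction₂ := by
  refine ⟨(measurable_adAction₂ _).aemeasurable, ?_⟩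
  rw [toyPairLaw, Measure.map_smul, Measure.map_add _ _ (measurable_adAction₂ _),
    Measure.map_dirac' (measurable_adAction₂ _), Measure.map_dirac' (measurable_adAction₂ _),
    adAction₂_phaseU_toy, adAction₂_phaseU_toy_neg, add_comm]

/-- Any insert is integrable against a Dirac mass on a space with measurable points (it is a.e. constant).
[folklore] -/
theorem integrable_dirac_of_measurableSingleton {Y : Type*} [MeasurableSpace Y] [MeasurableSingletonClass Y]
    {G : Type*} [NormedAddCommGroup G] (f : Y → G) (y : Y) : Integrable f (Measure.dirac y) :=
  (integrable_const (f y)).congr (ae_eq_dirac f).symm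

/-- **(A5′) THE MEAN COMMUTATOR OF THE PAIR TOY IS `[E, F] = diag(2i, −2i)`** — axial, as (A4) predicts, and
NON-ZERO. [folklore] -/
theorem toyPair_integral_pairComm : ∫ p, pairComm p ∂toyPairLaw = axial (2 * I) := by
  have hI : ∀ y : (Fin 2 → Fin 2 → ℂ) × (Fin 2 → Fin 2 → ℂ), Integrable pairComm (Measure.dirac y) :=
    fun y => integrable_dirac_of_measurableSingleton pairComm y
  have hneg : pairComm (-toyE, -toyF) = pairComm (toyE, toyF) := pairComm_neg (toyE, toyF)
  rw [toyPairLaw, integral_smul_measure, integral_add_measure (hI _) (hI _), integral_dirac, integral_dirac, hneg,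
    pairComm_toy, ← two_smul ℝ (axial (2 * I)), smul_smul, ENNReal.toReal_inv, ENNReal.toReal_ofNat,
    inv_mul_cancel₀ (two_ne_zero : (2 : ℝ) ≠ 0), one_smul]

/-- … hence non-zero: under (A1′) the mean of the COMMUTATOR of two equivariant inserts NEED NOT vanish — O-G7's
«may keep a Θ̂₀-component» is SHARP at the level of symmetry. [folklore] -/
theorem toyPair_integral_pairComm_ne_zero : ∫ p, pairComm p ∂toyPairLaw ≠ 0 := by
  rw [toyPair_integral_pairComm, Ne, axial_eq_zero_iff]
  exact mul_ne_zero two_ne_zero I_ne_zero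

/-- **(A5′)** the pair toy law is NOT (k3)-invariant: at a (k3)-invariant law K9 (`T4CoReadMoment.integral_mcomm_eq_zero`)
forces the mean commutator of equivariant inserts to vanish. [folklore] -/
theorem toyPair_not_flat : ¬ FlatExteriorConjInvariant toyPairLaw adAction₂ := fun hflat =>
  toyPair_integral_pairComm_ne_zero (integral_mcomm_eq_zero hflat fst_conjEquivariant₂ snd_conjEquivariant₂)

/-- **(A5″) ORBIT LEMMA**: along the whole U(1) AXIS ORBIT of a pair whose commutator is axial, the commutator insert is
CONSTANT — `[hXh⋆, hYh⋆] = h[X, Y]h⋆ = [X, Y]` for `h` on the axis. [folklore] -/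
theorem pairComm_adAction₂_of_isAxis (h : Matrix.specialUnitaryGroup (Fin 2) ℂ) (hh : IsAxis h)
    {p : (Fin 2 → Fin 2 → ℂ) × (Fin 2 → Fin 2 → ℂ)} {a : ℂ} (hp : pairComm p = axial a) :
    pairComm (adAction₂ h p) = axial a := by
  rw [pairComm_conjEquivariant h p, hp]
  exact conjOp_axial_of_isAxis h hh a

/-- **(A5″)** consequently ANY probability law carried by the axis orbit of `(E, F)` — in particular the orbit measure,
the natural fully (A1)-invariant instance (not constructed here) — has mean commutator `[E, F] = diag(2i, −2i) ≠ 0`: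
averaging over the residual symmetry cannot kill the commutator channel. [folklore] -/
theorem integral_pairComm_eq_of_orbit {ν : Measure ((Fin 2 → Fin 2 → ℂ) × (Fin 2 → Fin 2 → ℂ))}
    [IsProbabilityMeasure ν]
    (hν : ∀ᵐ p ∂ν, ∃ h : Matrix.specialUnitaryGroup (Fin 2) ℂ, IsAxis h ∧ p = adAction₂ h (toyE, toyF)) :
    ∫ p, pairComm p ∂ν = axial (2 * I) := by
  have hae : (fun p => pairComm p) =ᵐ[ν] fun _ => axial (2 * I) := by
    filter_upwards [hν] with p hp
    obtain ⟨h, hh, rfl⟩ := hp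
    exact pairComm_adAction₂_of_isAxis h hh pairComm_toy
  rw [integral_congr_ae hae, integral_const]
  simp

end PairToy

/-! ## §2ter (A3″)  Transverse inserts have mean zero under the residual symmetry (v1.2) -/

section Transverse

variable {X : Type*} [MeasurableSpace X] {μ : Measure X} {T : Matrix.specialUnitaryGroup (Fin 2) ℂ → X → X}

/-- Evaluation at the entry `(i, j)`, as a continuous ℝ-linear functional on `Fin 2 → Fin 2 → ℂ`. [folklore] -/
def entryOp (i j : Fin 2) : (Fin 2 → Fin 2 → ℂ) →L[ℝ] ℂ :=
  LinearMap.toContinuousLinearMap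
    { toFun := fun v => v i j
      map_add' := fun _ _ => rfl
      map_smul' := fun _ _ => rfl }

/-- `entryOp i j v = v i j`. [folklore] -/
@[simp] theorem entryOp_apply (i j : Fin 2) (v : Fin 2 → Fin 2 → ℂ) : entryOp i j v = v i j := rfl

/-- Entries commute with the Bochner integral (integrable integrand). [folklore] -/
theorem integral_apply_eq {f : X → Fin 2 → Fin 2 → ℂ} (hf : Integrable f μ) (i j : Fin 2) :
    (∫ x, f x ∂μ) i j = ∫ x, f x i j ∂μ := by
  have h := ContinuousLinearMap.integral_comp_comm (entryOp i j) hf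
  simpa only [entryOp_apply] using h.symm

/-- **(A3″) TRANSVERSE INSERTS HAVE MEAN ZERO under (A1′)** (hence under (A1) and (k3)): an equivariant insert with
a.e. ZERO DIAGONAL has `∫ f ∂μ = 0` — the off-diagonal entries of the mean vanish by (A3), the diagonal entries are
means of a.e.-null scalars; no integrability needed (non-integrable ⇒ junk value 0). [folklore] -/
theorem integral_eq_zero_of_ae_transverse_of_phase (hμ : PhaseConjInvariant μ T) {f : X → Fin 2 → Fin 2 → ℂ}
    (hf : ConjEquivariant T f) (hdiag : ∀ᵐ x ∂μ, f x 0 0 = 0 ∧ f x 1 1 = 0) : ∫ x, f x ∂μ = 0 := by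
  by_cases hint : Integrable f μ
  · have hoff := integral_offDiag_eq_zero_of_phase hμ hf
    have h00 : ∫ x, f x 0 0 ∂μ = 0 := by
      rw [integral_congr_ae (show (fun x => f x 0 0) =ᵐ[μ] fun _ => (0 : ℂ) from hdiag.mono fun x hx => hx.1),
        integral_zero]
    have h11 : ∫ x, f x 1 1 ∂μ = 0 := by
      rw [integral_congr_ae (show (fun x => f x 1 1) =ᵐ[μ] fun _ => (0 : ℂ) from hdiag.mono fun x hx => hx.2),
        integral_zero]
    funext i j
    fin_cases i <;> fin_cases j
    · rw [integral_apply_eq hint]; exact h00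
    · exact hoff.1
    · exact hoff.2
    · rw [integral_apply_eq hint]; exact h11
  · exact integral_undef hint

/-- (A3″) under (A1). [folklore] -/
theorem integral_eq_zero_of_ae_transverse (hμ : AxisConjInvariant μ T) {f : X → Fin 2 → Fin 2 → ℂ}
    (hf : ConjEquivariant T f) (hdiag : ∀ᵐ x ∂μ, f x 0 0 = 0 ∧ f x 1 1 = 0) : ∫ x, f x ∂μ = 0 :=
  integral_eq_zero_of_ae_transverse_of_phase hμ.phase hf hdiag

end Transverse

/-! ## §3ter (A5‴)  The ORBIT MEASURE: a fully (A1)-invariant probability law whose mean commutator is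
`diag(2i, −2i) ≠ 0` (v1.2; discharges the «not constructed here» of (A5″)) -/

section OrbitMeasure

open scoped ComplexConjugate

/-- The matrix `[[0, a], [b, 0]]` with ZERO DIAGONAL (a transverse element), in the function type. [folklore] -/
def offDiag (a b : ℂ) : Fin 2 → Fin 2 → ℂ := ![![0, a], ![b, 0]]

/-- entry (0,0) of `offDiag a b` is `0`. [folklore] -/
@[simp] theorem offDiag_apply_00 (a b : ℂ) : offDiag a b 0 0 = 0 := rfl

/-- entry (0,1) of `offDiag a b` is `a`. [folklore] -/
@[simp] theorem offDiag_apply_01 (a b : ℂ) : offDiag a b 0 1 = a := rfl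

/-- entry (1,0) of `offDiag a b` is `b`. [folklore] -/
@[simp] theorem offDiag_apply_10 (a b : ℂ) : offDiag a b 1 0 = b := rfl

/-- entry (1,1) of `offDiag a b` is `0`. [folklore] -/
@[simp] theorem offDiag_apply_11 (a b : ℂ) : offDiag a b 1 1 = 0 := rfl

/-- `E = offDiag 1 (−1)`. [folklore] -/
theorem toyE_eq_offDiag : toyE = offDiag 1 (-1) := rfl

/-- `F = offDiag i i`. [folklore] -/
theorem toyF_eq_offDiag : toyF = offDiag I I := rfl

/-- `offDiag` is linear in its two entries. [folklore] -/
theorem offDiag_eq_smul_add (a b : ℂ) : offDiag a b = a • offDiag 1 0 + b • offDiag 0 1 := by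
  funext i j
  fin_cases i <;> fin_cases j <;> simp

/-- `(a, b) ↦ offDiag a b` is continuous. [folklore] -/
theorem continuous_offDiag : Continuous fun q : ℂ × ℂ => offDiag q.1 q.2 := by
  have h : (fun q : ℂ × ℂ => offDiag q.1 q.2) = fun q => q.1 • offDiag 1 0 + q.2 • offDiag 0 1 :=
    funext fun q => offDiag_eq_smul_add q.1 q.2
  rw [h]
  exact (continuous_fst.smul continuous_const).add (continuous_snd.smul continuous_const)

/-- The axis matrix `diag(w, w̄)`. [folklore] -/
def axisMat (w : ℂ) : Matrix (Fin 2) (Fin 2) ℂ := !![w, 0; 0, conj w]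

/-- For `|w| = 1`, `diag(w, w̄) ∈ SU(2)`. [folklore] -/
theorem axisMat_mem (w : Circle) : axisMat (w : ℂ) ∈ Matrix.specialUnitaryGroup (Fin 2) ℂ := by
  have hw : (w : ℂ) * conj (w : ℂ) = 1 := by
    rw [mul_conj', Circle.norm_coe]; simp
  have hw' : conj (w : ℂ) * (w : ℂ) = 1 := by rw [mul_comm]; exact hw
  rw [Matrix.mem_specialUnitaryGroup_iff]
  refine ⟨?_, ?_⟩
  · rw [Matrix.mem_unitaryGroup_iff]
    ext i j
    fin_cases i <;> fin_cases j <;>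
      simp [axisMat, Matrix.mul_apply, Fin.sum_univ_two, Matrix.star_apply, hw, hw']
  · simp [axisMat, Matrix.det_fin_two, hw]

/-- The axis element `diag(w, w̄) ∈ SU(2)` for `w` on the unit circle: the U(1) stabiliser of `σ₃`, parametrised.
[folklore] -/
def axisU (w : Circle) : Matrix.specialUnitaryGroup (Fin 2) ℂ := ⟨axisMat (w : ℂ), axisMat_mem w⟩

/-- `axisU w` is on the axis. [folklore] -/
theorem axisU_isAxis (w : Circle) : IsAxis (axisU w) := by
  constructor <;> simp [axisU, axisMat]

/-- Conversely EVERY axis element of SU(2) is `diag(w, w̄)` for some `|w| = 1` (unitarity gives `|h₀₀| = 1`,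
`det = 1` gives `h₁₁ = h̄₀₀`). [folklore] -/
theorem IsAxis.exists_eq_axisU {h : Matrix.specialUnitaryGroup (Fin 2) ℂ} (hh : IsAxis h) :
    ∃ w : Circle, h = axisU w := by
  obtain ⟨h01, h10⟩ := hh
  have hmem := Matrix.mem_specialUnitaryGroup_iff.mp h.prop
  have hU : (h : Matrix (Fin 2) (Fin 2) ℂ) * star (h : Matrix (Fin 2) (Fin 2) ℂ) = 1 :=
    Matrix.mem_unitaryGroup_iff.mp hmem.1
  have h00 : (h : Matrix (Fin 2) (Fin 2) ℂ) 0 0 * conj ((h : Matrix (Fin 2) (Fin 2) ℂ) 0 0) = 1 := by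
    have := congrFun (congrFun hU 0) 0
    simpa [Matrix.mul_apply, Fin.sum_univ_two, Matrix.star_apply, h01] using this
  have hdet : (h : Matrix (Fin 2) (Fin 2) ℂ) 0 0 * (h : Matrix (Fin 2) (Fin 2) ℂ) 1 1 = 1 := by
    have := hmem.2
    rwa [Matrix.det_fin_two, h01, zero_mul, sub_zero] at this
  have h11 : (h : Matrix (Fin 2) (Fin 2) ℂ) 1 1 = conj ((h : Matrix (Fin 2) (Fin 2) ℂ) 0 0) := by
    calc (h : Matrix (Fin 2) (Fin 2) ℂ) 1 1
        = ((h : Matrix (Fin 2) (Fin 2) ℂ) 0 0 * conj ((h : Matrix (Fin 2) (Fin 2) ℂ) 0 0))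
            * (h : Matrix (Fin 2) (Fin 2) ℂ) 1 1 := by rw [h00, one_mul]
      _ = conj ((h : Matrix (Fin 2) (Fin 2) ℂ) 0 0)
            * ((h : Matrix (Fin 2) (Fin 2) ℂ) 0 0 * (h : Matrix (Fin 2) (Fin 2) ℂ) 1 1) := by ring
      _ = conj ((h : Matrix (Fin 2) (Fin 2) ℂ) 0 0) := by rw [hdet, mul_one]
  have hnorm : ‖(h : Matrix (Fin 2) (Fin 2) ℂ) 0 0‖ = 1 := by
    have h2 : ‖(h : Matrix (Fin 2) (Fin 2) ℂ) 0 0‖ ^ 2 = 1 := by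
      have := congrArg (fun z : ℂ => ‖z‖) h00
      simpa [norm_mul, Complex.norm_conj, sq] using this
    exact (pow_eq_one_iff_of_nonneg (norm_nonneg _) two_ne_zero).mp h2
  refine ⟨⟨(h : Matrix (Fin 2) (Fin 2) ℂ) 0 0, mem_sphere_zero_iff_norm.2 hnorm⟩, ?_⟩
  apply Subtype.ext
  ext i j
  fin_cases i <;> fin_cases j
  · rfl
  · exact h01
  · exact h10
  · exact h11

/-- The adjoint action of `diag(w, w̄)` on a transverse element ROTATES it: `offDiag a b ↦ offDiag (w² a) (w̄² b)`.
[folklore] -/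
theorem adAction_axisU_offDiag (w : Circle) (a b : ℂ) :
    adAction (axisU w) (offDiag a b) = offDiag ((w : ℂ) ^ 2 * a) (conj (w : ℂ) ^ 2 * b) := by
  funext i j
  fin_cases i <;> fin_cases j <;>
    simp [adAction, conjOp_apply, axisU, axisMat, Matrix.mul_apply, Fin.sum_univ_two, Matrix.star_apply,
      Matrix.of_apply, offDiag] <;> ring

/-- The U(1) AXIS ORBIT of the pair `(E, F)`, parametrised by the unit circle: `u ↦ (offDiag u (−ū), offDiag (iu) (iū))`
(`u = w²` for the acting element `diag(w, w̄)`). [folklore] -/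
def orbitPt (u : ℂ) : (Fin 2 → Fin 2 → ℂ) × (Fin 2 → Fin 2 → ℂ) :=
  (offDiag u (-conj u), offDiag (I * u) (I * conj u))

/-- The base point: `orbitPt 1 = (E, F)`. [folklore] -/
theorem orbitPt_one : orbitPt 1 = (toyE, toyF) := by
  simp [orbitPt, toyE_eq_offDiag, toyF_eq_offDiag, map_one]

/-- The axis acts on the orbit by ROTATION of the parameter: `Ad(diag(w, w̄)) (orbitPt u) = orbitPt (w² u)`. [folklore] -/
theorem adAction₂_axisU_orbitPt (w : Circle) (u : ℂ) :
    adAction₂ (axisU w) (orbitPt u) = orbitPt ((w : ℂ) ^ 2 * u) := by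
  simp only [adAction₂, Prod.map_apply, orbitPt, adAction_axisU_offDiag, map_mul, map_pow]
  refine Prod.ext ?_ ?_ <;> (congr 1; ring)

/-- `orbitPt` is continuous. [folklore] -/
theorem continuous_orbitPt : Continuous orbitPt :=
  (continuous_offDiag.comp (continuous_id.prodMk (Complex.continuous_conj.neg))).prodMk
    (continuous_offDiag.comp
      ((continuous_const.mul continuous_id).prodMk (continuous_const.mul Complex.continuous_conj)))

/-- `toCircle : ℝ/ℤ → U(1)` is onto (it is a homeomorphism, `AddCircle.homeomorphCircle`). [folklore] -/
theorem exists_toCircle_eq (z : Circle) : ∃ θ : AddCircle (1 : ℝ), AddCircle.toCircle θ = z :=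
  ⟨(AddCircle.homeomorphCircle one_ne_zero).symm z, by
    rw [← AddCircle.homeomorphCircle_apply one_ne_zero, Homeomorph.apply_symm_apply]⟩

/-- Square roots on U(1) along the parametrisation: `toCircle θ = (toCircle (θ/2))²`. [folklore] -/
theorem exists_sq_eq_toCircle (θ : AddCircle (1 : ℝ)) : ∃ w : Circle, w ^ 2 = AddCircle.toCircle θ := by
  induction θ using QuotientAddGroup.induction_on with
  | H x =>
    refine ⟨AddCircle.toCircle ((x / 2 : ℝ) : AddCircle (1 : ℝ)), ?_⟩
    rw [sq, ← AddCircle.toCircle_add, ← AddCircle.coe_add]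
    congr 2
    ring

/-- THE ORBIT MAP `θ ↦ orbitPt (e^{2πiθ})` from `ℝ/ℤ` (carrying the Haar probability measure) onto the axis orbit of
`(E, F)`. [folklore] -/
def orbitMap (θ : AddCircle (1 : ℝ)) : (Fin 2 → Fin 2 → ℂ) × (Fin 2 → Fin 2 → ℂ) :=
  orbitPt (AddCircle.toCircle θ : ℂ)

/-- `orbitMap` is continuous. [folklore] -/
theorem continuous_orbitMap : Continuous orbitMap :=
  continuous_orbitPt.comp (continuous_subtype_val.comp AddCircle.continuous_toCircle)

/-- `orbitMap` is measurable. [folklore] -/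
theorem measurable_orbitMap : Measurable orbitMap := continuous_orbitMap.measurable

/-- Every point of the orbit map IS an axis conjugate of `(E, F)`. [folklore] -/
theorem exists_orbitMap_eq_adAction₂ (θ : AddCircle (1 : ℝ)) :
    ∃ w : Circle, orbitMap θ = adAction₂ (axisU w) (toyE, toyF) := by
  obtain ⟨w, hw⟩ := exists_sq_eq_toCircle θ
  refine ⟨w, ?_⟩
  rw [← orbitPt_one, adAction₂_axisU_orbitPt, mul_one, orbitMap, ← hw, Circle.coe_pow]

/-- The axis acts on the orbit map by TRANSLATION of the parameter. [folklore] -/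
theorem adAction₂_axisU_orbitMap (w : Circle) {θ₀ : AddCircle (1 : ℝ)} (hθ₀ : AddCircle.toCircle θ₀ = w ^ 2)
    (θ : AddCircle (1 : ℝ)) : adAction₂ (axisU w) (orbitMap θ) = orbitMap (θ₀ + θ) := by
  rw [orbitMap, orbitMap, adAction₂_axisU_orbitPt, AddCircle.toCircle_add, hθ₀, Circle.coe_mul, Circle.coe_pow]

/-- **THE ORBIT MEASURE**: the image of the Haar probability measure of `ℝ/ℤ` under the orbit map — the normalised
U(1)-invariant law on the axis orbit of `(E, F)`. [folklore] -/
def orbitLaw : Measure ((Fin 2 → Fin 2 → ℂ) × (Fin 2 → Fin 2 → ℂ)) :=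
  Measure.map orbitMap (AddCircle.haarAddCircle (T := (1 : ℝ)))

/-- The orbit measure is a probability measure. [folklore] -/
instance orbitLaw_isProbabilityMeasure : IsProbabilityMeasure orbitLaw :=
  Measure.isProbabilityMeasure_map measurable_orbitMap.aemeasurable

/-- The orbit measure is invariant under every `Ad(diag(w, w̄))` (translation invariance of Haar measure on `ℝ/ℤ`).
[folklore] -/
theorem orbitLaw_map_adAction₂_axisU (w : Circle) : Measure.map (adAction₂ (axisU w)) orbitLaw = orbitLaw := by
  obtain ⟨θ₀, hθ₀⟩ := exists_toCircle_eq (w ^ 2)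
  have hcomp : adAction₂ (axisU w) ∘ orbitMap = orbitMap ∘ fun θ => θ₀ + θ :=
    funext fun θ => adAction₂_axisU_orbitMap w hθ₀ θ
  rw [orbitLaw, Measure.map_map (measurable_adAction₂ _) measurable_orbitMap, hcomp,
    ← Measure.map_map measurable_orbitMap (measurable_const_add θ₀), map_add_left_eq_self]

/-- **(A5‴) THE ORBIT MEASURE HAS THE FULL RESIDUAL AXIS SYMMETRY (A1)** — invariance under `Ad(h)` for EVERY `h` on
the axis (not only the π-rotation of (A1′)/(A5′)). [folklore] -/
theorem orbitLaw_axisConjInvariant : AxisConjInvariant orbitLaw adAction₂ := by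
  intro h hh
  obtain ⟨w, rfl⟩ := hh.exists_eq_axisU
  exact ⟨(measurable_adAction₂ _).aemeasurable, orbitLaw_map_adAction₂_axisU w⟩

/-- … in particular the single-element symmetry (A1′). [folklore] -/
theorem orbitLaw_phaseConjInvariant : PhaseConjInvariant orbitLaw adAction₂ :=
  orbitLaw_axisConjInvariant.phase

/-- The range of the orbit map (a continuous image of the compact `ℝ/ℤ`) is measurable. [folklore] -/
theorem measurableSet_range_orbitMap : MeasurableSet (Set.range orbitMap) :=
  (isCompact_range continuous_orbitMap).isClosed.measurableSet

/-- The orbit measure is CARRIED BY THE AXIS ORBIT of `(E, F)` (the hypothesis of (A5″)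
`integral_pairComm_eq_of_orbit`). [folklore] -/
theorem orbitLaw_ae_mem_orbit :
    ∀ᵐ p ∂orbitLaw, ∃ h : Matrix.specialUnitaryGroup (Fin 2) ℂ, IsAxis h ∧ p = adAction₂ h (toyE, toyF) := by
  filter_upwards [ae_map_mem_range orbitMap measurableSet_range_orbitMap
    (AddCircle.haarAddCircle (T := (1 : ℝ)))] with p hp
  obtain ⟨θ, rfl⟩ := hp
  obtain ⟨w, hw⟩ := exists_orbitMap_eq_adAction₂ θ
  exact ⟨axisU w, axisU_isAxis w, hw⟩

/-- **(A5‴) THE MEAN COMMUTATOR UNDER THE ORBIT MEASURE IS `[E, F] = diag(2i, −2i)`** ((A5″) made unconditional).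
[folklore] -/
theorem orbitLaw_integral_pairComm : ∫ p, pairComm p ∂orbitLaw = axial (2 * I) :=
  integral_pairComm_eq_of_orbit orbitLaw_ae_mem_orbit

/-- … hence NON-ZERO: averaging over the FULL residual U(1) does not kill the commutator channel. [folklore] -/
theorem orbitLaw_integral_pairComm_ne_zero : ∫ p, pairComm p ∂orbitLaw ≠ 0 := by
  rw [orbitLaw_integral_pairComm, Ne, axial_eq_zero_iff]
  exact mul_ne_zero two_ne_zero I_ne_zero

/-- **(A5‴)** and the orbit measure is NOT (k3)-invariant (K9 would force the mean commutator to vanish): a fully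
(A1)-invariant law strictly outside (k3) with a surviving axial pair scalar. [folklore] -/
theorem orbitLaw_not_flat : ¬ FlatExteriorConjInvariant orbitLaw adAction₂ := fun hflat =>
  orbitLaw_integral_pairComm_ne_zero (integral_mcomm_eq_zero hflat fst_conjEquivariant₂ snd_conjEquivariant₂)

/-- Under the orbit measure BOTH coordinate inserts are a.e. TRANSVERSE (zero diagonal). [folklore] -/
theorem orbitLaw_ae_diag_eq_zero :
    ∀ᵐ p ∂orbitLaw, (p.1 0 0 = 0 ∧ p.1 1 1 = 0) ∧ (p.2 0 0 = 0 ∧ p.2 1 1 = 0) := by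
  filter_upwards [ae_map_mem_range orbitMap measurableSet_range_orbitMap
    (AddCircle.haarAddCircle (T := (1 : ℝ)))] with p hp
  obtain ⟨θ, rfl⟩ := hp
  simp [orbitMap, orbitPt]

/-- **(A5‴) FIRST ORDER AVERAGES OUT, THE COMMUTATOR DOES NOT**: under the orbit measure the first coordinate insert
(equivariant, transverse) has mean ZERO ((A3″)) … [folklore] -/
theorem orbitLaw_integral_fst : ∫ p, p.1 ∂orbitLaw = 0 :=
  integral_eq_zero_of_ae_transverse orbitLaw_axisConjInvariant fst_conjEquivariant₂
    (orbitLaw_ae_diag_eq_zero.mono fun _ h => h.1)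

/-- … and so has the second, while their commutator has mean `diag(2i, −2i) ≠ 0` (`orbitLaw_integral_pairComm`): the
surviving axial pair scalar is a genuinely SECOND-ORDER quantity that no first-order (single-insert) symmetry
bookkeeping sees. [folklore] -/
theorem orbitLaw_integral_snd : ∫ p, p.2 ∂orbitLaw = 0 :=
  integral_eq_zero_of_ae_transverse orbitLaw_axisConjInvariant snd_conjEquivariant₂
    (orbitLaw_ae_diag_eq_zero.mono fun _ h => h.2)

/-! ### (A5′) versus (A5‴): the pair toy law is NOT fully (A1)-invariant (cross-read advisory A2 of v1.1, C-pv04g8-3,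
made a kernel fact) -/

/-- `orbitPt (−1) = (−E, −F)`: the second atom of the pair toy law is the antipode of the base point on the orbit.
[folklore] -/
theorem orbitPt_neg_one : orbitPt (-1) = (-toyE, -toyF) := by
  refine Prod.ext ?_ ?_ <;> funext i j <;> fin_cases i <;> fin_cases j <;> simp [orbitPt, toyE, toyF]

/-- The orbit parameter is entry `(0,1)` of the first component; in particular `orbitPt` is injective. [folklore] -/
theorem orbitPt_injective : Function.Injective orbitPt := fun u v h => by
  have := congrArg (fun p : (Fin 2 → Fin 2 → ℂ) × (Fin 2 → Fin 2 → ℂ) => p.1 0 1) h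
  simpa [orbitPt] using this

/-- A point `w` of U(1) with `w² = i`, obtained through the parametrisation (no trigonometry). [folklore] -/
theorem exists_sq_eq_I : ∃ w : Circle, (w : ℂ) ^ 2 = I := by
  obtain ⟨θ, hθ⟩ := exists_toCircle_eq ⟨I, mem_sphere_zero_iff_norm.2 Complex.norm_I⟩
  obtain ⟨w, hw⟩ := exists_sq_eq_toCircle θ
  refine ⟨w, ?_⟩
  rw [← Circle.coe_pow, hw, hθ]

/-- **(A5′) vs (A5‴)**: the pair toy law `½(δ_(E,F) + δ_(−E,−F))` of (A5′) has the single-element symmetry (A1′)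
(`toyPair_phaseConjInvariant`) but NOT the full residual symmetry (A1): `Ad(diag(w, w̄))` with `w² = i` moves both
atoms off `(E, F)` (to `orbitPt (±i)`), so the image law gives the atom `(E, F)` mass `0 ≠ ½`.  The orbit measure
(A5‴) is the (A1)-invariant law on the same orbit. [folklore] -/
theorem toyPair_not_axisConjInvariant : ¬ AxisConjInvariant toyPairLaw adAction₂ := by
  intro hinv
  obtain ⟨w, hw⟩ := exists_sq_eq_I
  have hI : (I : ℂ) ≠ 1 := fun h => by simpa using congrArg Complex.re h
  have hnI : (-I : ℂ) ≠ 1 := fun h => by simpa using congrArg Complex.re h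
  have hn1 : (-1 : ℂ) ≠ 1 := fun h => by norm_num at h
  have hTa : adAction₂ (axisU w) (toyE, toyF) = orbitPt I := by
    rw [← orbitPt_one, adAction₂_axisU_orbitPt, mul_one, hw]
  have hTb : adAction₂ (axisU w) (-toyE, -toyF) = orbitPt (-I) := by
    rw [← orbitPt_neg_one, adAction₂_axisU_orbitPt, hw, mul_neg_one]
  have ha : orbitPt I ≠ (toyE, toyF) := fun h => hI (orbitPt_injective (h.trans orbitPt_one.symm))
  have hb : orbitPt (-I) ≠ (toyE, toyF) := fun h => hnI (orbitPt_injective (h.trans orbitPt_one.symm))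
  have hab : (-toyE, -toyF) ≠ (toyE, toyF) := fun h =>
    hn1 (orbitPt_injective ((orbitPt_neg_one.trans h).trans orbitPt_one.symm))
  have hmap := (hinv (axisU w) (axisU_isAxis w)).2
  rw [toyPairLaw, Measure.map_smul, Measure.map_add _ _ (measurable_adAction₂ _),
    Measure.map_dirac' (measurable_adAction₂ _), Measure.map_dirac' (measurable_adAction₂ _), hTa, hTb] at hmap
  have h := congrArg (fun m : Measure ((Fin 2 → Fin 2 → ℂ) × (Fin 2 → Fin 2 → ℂ)) => m {(toyE, toyF)}) hmap
  simp [Measure.smul_apply, Measure.add_apply, Set.mem_singleton_iff, ha, hb, hab] at h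
  exact absurd h.symm (ENNReal.inv_ne_zero.mpr ENNReal.ofNat_ne_top)

end OrbitMeasure

end Literature.MathematicalPhysics.QuantumFieldTheory.Balaban1983to89.T4CoReadAxial
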